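import Literature.Probability.Percolation.StochasticDominationProofs
import Literature.Probability.Percolation.PercolationEvents
import HarnessLib

/-!
# Crux `PercBurnResprinkle.VacantReignition` (stmt-CriticalPhenomena-7203), line `strip-fresh-field-lss`,
# stub `stub_lssFinite` — the finite-dimensional Liggett–Schonmann–Stacey domination theorem

What is proved: for every dimension `d`, range `M` and density `ρ < 1` there is `δ > 0` such that
every `M`-dependent family of events `X_x`, `x ∈ ℤ^d` (sub-families indexed by sets at sup-distance
`> M` are independent) with `P(X_x) ≥ 1 - δ` dominates every independent family `Y_x` with
`P'(Y_x) ≤ ρ` on increasing events `E` of the random set that are determined by finitely many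
coordinates: `P'({x | Y_x} ∈ E) ≤ P({x | X_x} ∈ E)`.

Source: T. M. Liggett, R. H. Schonmann, A. M. Stacey, *Domination by product measures*,
Ann. Probab. **25** (1997) 71–95, Theorem 0.0 (i)–(ii) / Theorem 1.3 with Corollary 1.4
(§1, pp. 76–82). The general statement (all increasing *measurable* events) is the Literature
theorem `Literature.Probability.Percolation.LiggettSchonmannStacey1997_dominatesProduct_holds`
(`Literature/Probability/Percolation/StochasticDominationProofs.lean`, which follows the printed
proof: Lemma 1.1 by the step-by-step coupling, Proposition 1.2, Theorem 1.3, transfer to `ℤ^d`);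
the present finite-dimensional form is its corollary, since an event determined by a finite set
of coordinates is measurable for the product σ-algebra on `Set (Fin d → ℤ)`
(`Literature.Probability.Percolation.DeterminedBy.measurableSet_of_finset`, Grimmett 1999 §2.2).
No new definitions.
-/

noncomputable section

namespace Summit.CriticalPhenomena.PercolationContinuityZ3.Theorems

open MeasureTheory ProbabilityTheory Literature.Probability.Percolation

/-- **Liggett–Schonmann–Stacey domination, finite-dimensional form** (LSS 1997, Thm 0.0 (i)–(ii) =
Thm 1.3 + Cor 1.4, for cylinder events): for all `d, M` and `ρ < 1` there is `δ > 0` such that an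
`M`-dependent family of events on `ℤ^d` with marginals `≥ 1 - δ` dominates, on every increasing
event determined by a finite set `F` of sites, every independent family with marginals `≤ ρ`.
Corollary of `LiggettSchonmannStacey1997_dominatesProduct_holds` (all increasing measurable
events) and `DeterminedBy.measurableSet_of_finset`. [cite: LiggettSchonmannStacey1997, Thm 1.3] -/
theorem stub_lssFinite :
    ∀ (d M : ℕ) (ρ : ℝ), ρ < 1 → ∃ δ : ℝ, 0 < δ ∧
      ∀ (Ω Ω' : Type) [MeasurableSpace Ω] [MeasurableSpace Ω']
        (P : Measure Ω) (P' : Measure Ω') [IsProbabilityMeasure P] [IsProbabilityMeasure P']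
        (X : (Fin d → ℤ) → Set Ω) (Y : (Fin d → ℤ) → Set Ω'),
        (∀ x, MeasurableSet (X x)) → (∀ x, MeasurableSet (Y x)) →
        (∀ A B : Set (Fin d → ℤ), (∀ a ∈ A, ∀ b ∈ B, (M : ℝ) < dist a b) →
          ProbabilityTheory.Indep (MeasurableSpace.generateFrom (X '' A))
            (MeasurableSpace.generateFrom (X '' B)) P) →
        (∀ x, 1 - δ ≤ P.real (X x)) →
        ProbabilityTheory.iIndepSet Y P' → (∀ x, P'.real (Y x) ≤ ρ) →
        ∀ (F : Finset (Fin d → ℤ)) (E : Set (Set (Fin d → ℤ))), IsUpperSet E →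
          DeterminedBy E (↑F : Set (Fin d → ℤ)) →
          P'.real {ω' | {x | ω' ∈ Y x} ∈ E} ≤ P.real {ω | {x | ω ∈ X x} ∈ E} := by
  intro d M ρ hρ
  obtain ⟨δ, hδ, h⟩ := LiggettSchonmannStacey1997_dominatesProduct_holds d M ρ hρ
  exact ⟨δ, hδ, fun Ω Ω' _ _ P P' _ _ X Y hX hY hind hdens hYind hYp _ E hE hEF =>
    h Ω Ω' P P' X Y hX hY hind hdens hYind hYp E hE hEF.measurableSet_of_finset⟩

end Summit.CriticalPhenomena.PercolationContinuityZ3.Theorems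

end
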